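import Mathlib
import Summits.Schanuel.Schanuel.Theses.RigidCore
import Summits.Schanuel.Schanuel.Theorems.RigidCoreSchanuelOnLogFreeCoreCalibrationA
import Summits.Schanuel.Schanuel.Theorems.RigidCoreSchanuelOnLogFreeCoreCalibrationB
import Summits.Schanuel.Schanuel.Theorems.RigidCoreSchanuelOnLogFreeCoreSplitExact

/-!
# Line `generic-period-fibre` (route `RigidCore`): the crux is sandwiched `SC ⟹ (R) ⟹ e ⊥ π`

Registered stub `stub_sandwich` of line `generic-period-fibre` of crux `stmt-Schanuel-0970`
(`Summit.Schanuel.Schanuel.Theses.RigidCore.SchanuelOnLogFreeCore`, (R) = Schanuel's conjecture for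
`ℚ`-linearly independent tuples from the log-free core `C_EA`).  This short file assembles, from landed
theorems of the line, the CALIBRATION CHAIN that fixes the logical position of the crux and of its two
residue stubs A (Schanuel on the kernel-free core `M`) and B (relative Schanuel of `C_EA` over `M`):

  `SchanuelConjecture ⟹ (R) ⟺ A ∧ B`,  `A ⟹ ExpOnePiAlgebraicIndependent` (e ⊥ π, printed OPEN),
  `SchanuelConjecture ⟹ B`,  and `B ⟹ (π ∈ M ∨ e^{π²} transcendental)`.

* `Sandwich.crux_of_schanuelConjecture` — (R) is an instance of Schanuel's conjecture (drop the
  membership hypothesis); so ¬(R) would refute SC.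
* `Sandwich.expOnePi_of_crux` — (R) ⟹ `Literature.NumberTheory.Transcendental.ExpOnePiAlgebraicIndependent`
  (`SplitExact.stubA_of_crux`, p98645, then `stub_calibA_expOnePi`, p75332); so (R) is at least as hard
  as the algebraic independence of `e` and `π`.
* `Sandwich.stubB_of_schanuelConjecture` — SC ⟹ B (`SplitExact.stubB_of_crux` after the first item): stub B
  is NOT an over-strengthening of Schanuel's conjecture.
* `Sandwich.pi_mem_or_transcendental_of_stubB` — B ⟹ `π ∈ M ∨ Transcendental ℚ (exp (π²))`
  (`stub_calibB_expPiSq`, p75670): where B is non-vacuous it carries a printed-open statement.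
* the registered verbatim form `stub_sandwich` = the two outer implications.

Everything is a one-line composition of landed declarations; nothing new is claimed.  Sources: line card
`Cruxes/SchanuelOnLogFreeCore/Lines/generic-period-fibre.md`; cdisprove `Disproof.lean` §(e)/(h)
(`crux_of_schanuel`, `expOnePiAlgebraicIndependent_of_crux` — the same facts, not under `Theorems/`);
M. Waldschmidt, *Diophantine approximation on linear algebraic groups* (2000) §1.4 for the open status of
`e ⊥ π` and `e^{π²} ∉ ℚ̄`.
-/

noncomputable section

namespace Summit.Schanuel.Schanuel.Theorems.RigidCore

open Summit.Schanuel.Schanuel.Theses.RigidCore (SchanuelOnLogFreeCore)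

namespace Sandwich

/-- **SC ⟹ (R)**: the crux is the instance of Schanuel's conjecture at tuples from `C_EA` (forget the
membership hypothesis). -/
theorem crux_of_schanuelConjecture (h : Literature.Periods.SchanuelConjecture) : SchanuelOnLogFreeCore :=
  fun n x _ hli => h n x hli

/-- **(R) ⟹ e ⊥ π**: the crux implies the algebraic independence of `e` and `π` (tree statement
`ExpOnePiAlgebraicIndependent`, printed open) — restrict (R) to the kernel-free core (stub A) and apply
the landed calibration `stub_calibA_expOnePi`. -/
theorem expOnePi_of_crux (hR : SchanuelOnLogFreeCore) :
    Literature.NumberTheory.Transcendental.ExpOnePiAlgebraicIndependent :=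
  stub_calibA_expOnePi (SplitExact.stubA_of_crux hR)

/-- **SC ⟹ B**: Schanuel's conjecture implies stub B (relative Schanuel of `C_EA` over `M`), via (R) and
the hull count `SplitExact.stubB_of_crux`; so B is a genuine consequence of SC, not an over-strengthening. -/
theorem stubB_of_schanuelConjecture (h : Literature.Periods.SchanuelConjecture) (n : ℕ) (x : Fin n → ℂ)
    (hx : ∀ i, x i ∈ eaFibre (2 * ↑Real.pi * Complex.I))
    (hli : LinearIndependent ℚ ((Submodule.span ℚ (kernelFreeCore : Set ℂ)).mkQ ∘ x)) :
    (n : Cardinal) ≤ Algebra.trdeg ↥kernelFreeCore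
      ↥(IntermediateField.adjoin ↥kernelFreeCore (Set.range x ∪ Set.range (Complex.exp ∘ x))) :=
  SplitExact.stubB_of_crux (crux_of_schanuelConjecture h) n x hx hli

/-- **B ⟹ (π ∈ M) ∨ e^{π²} transcendental**: either stub B is vacuous (`π ∈ M`, equivalently
`C_EA = M`, `CalibrationB.logFreeCore_eq_kernelFreeCore_iff`) or it yields the printed-open transcendence
of `e^{π²}` (`stub_calibB_expPiSq`). -/
theorem pi_mem_or_transcendental_of_stubB
    (hB : ∀ (n : ℕ) (x : Fin n → ℂ), (∀ i, x i ∈ eaFibre (2 * ↑Real.pi * Complex.I)) →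
      LinearIndependent ℚ ((Submodule.span ℚ (kernelFreeCore : Set ℂ)).mkQ ∘ x) →
        (n : Cardinal) ≤ Algebra.trdeg ↥kernelFreeCore
          ↥(IntermediateField.adjoin ↥kernelFreeCore (Set.range x ∪ Set.range (Complex.exp ∘ x)))) :
    (Real.pi : ℂ) ∈ kernelFreeCore ∨ Transcendental ℚ (Real.exp (Real.pi ^ 2)) := by
  by_cases hpi : (Real.pi : ℂ) ∈ kernelFreeCore
  · exact Or.inl hpi
  · exact Or.inr (stub_calibB_expPiSq hB hpi)

end Sandwich

/-- **Registered stub `stub_sandwich` of line `generic-period-fibre`** (signature verbatim): the crux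
(R) is sandwiched between Schanuel's conjecture and the algebraic independence of `e` and `π`:
`SchanuelConjecture ⟹ (R)` and `(R) ⟹ ExpOnePiAlgebraicIndependent`.  With `stub_splitExact`
((R) ⟺ A ∧ B) this places both residue stubs of the line strictly inside open territory:
refuting either refutes SC, proving both proves `e ⊥ π`. -/
theorem stub_sandwich :
    (Literature.Periods.SchanuelConjecture →
        Summit.Schanuel.Schanuel.Theses.RigidCore.SchanuelOnLogFreeCore) ∧
      (Summit.Schanuel.Schanuel.Theses.RigidCore.SchanuelOnLogFreeCore →
        Literature.NumberTheory.Transcendental.ExpOnePiAlgebraicIndependent) :=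
  ⟨Sandwich.crux_of_schanuelConjecture, Sandwich.expOnePi_of_crux⟩

end Summit.Schanuel.Schanuel.Theorems.RigidCore

end
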